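import Mathlib
import Literature.NumberTheory.ModularForms.LevelThreeForms
import HarnessLib

/-!
# The zero locus of `𝓟 = (3E₂(3τ) − E₂(τ))/2`: `𝓟(τ) ≠ 0` for `Im τ > √3/6`

[topic NumberTheory/ModularForms]

We locate the zeros of the weight-2 Eisenstein series `𝓟` of `Γ₀(3)` (`eisThree`) by the **norm
to level one**: the product over the four cosets of `Γ₀(3)` in `SL₂(ℤ)`,
`N(τ) := 𝓟(τ)·𝓟(τ/3)·𝓟((τ+1)/3)·𝓟((τ+2)/3)`,
is a holomorphic modular form of weight `8` for the full modular group (`normP_S`, `normP_T`, from the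
`Γ₀(3)`-law `𝓟(γτ) = (cτ+d)²𝓟(τ)`, `eisThree_smul`, itself from Mathlib's transformation law of
`E₂`, and the `W₃`-law `eisThree_fricke`), hence a multiple of `E₄²` (`dim M₈(SL₂(ℤ)) = 1`).
Consequently a zero `τ₀` of `𝓟` forces `E₄(3τ₀) = 0` (`N(3τ₀)` contains the factor `𝓟(τ₀)`), so
`3τ₀` lies in the `SL₂(ℤ)`-orbit of `ρ` and **`Im τ₀ ≤ √3/6`** (`im_le_of_eisThree_eq_zero`); in
particular **`𝓟(τ) ≠ 0` for `Im τ > √3/6`** (`eisThree_ne_zero_of_im_gt`), the input needed for the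
level-3 Green function of Zhou 2015, Remark 9 (`f₃ = Δ₃/𝓟` is holomorphic above height `√3/6`).

## References
* Zhou 2015, Remark 9. [cite: Zhou2015, Remark 9]
* the norm map `M_k(Γ₀(N)) → M_{k[SL₂(ℤ):Γ₀(N)]}(SL₂(ℤ))`. [folklore]
-/

noncomputable section

open Complex hiding I
open UpperHalfPlane hiding I
open Filter Topology ModularForm EisensteinSeries Real
open scoped MatrixGroups ModularForm Manifold

namespace Literature.NumberTheory.ModularForms

open Literature.NumberTheory.EllipticCurves.ModularForms (E₄_eq_zero_iff levelOne_apply_smul tendsto_E4_atImInfty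
  mulThree coe_mulThree mulThree_smul sl2zMk coe_sl2zMk_smul)

/-! ## `E₂` and `𝓟` under `SL₂(ℤ)` and `Γ₀(3)` -/

/-- **`E₂(γz) = (cz+d)²E₂(z) − 6ic(cz+d)/π`** for `γ ∈ SL₂(ℤ)` (Mathlib's `E2_slash_action`,
`D₂(γ)(z) = 2πic/(cz+d)`, `ζ(2) = π²/6`). [folklore] -/
theorem E2_smul (γ : SL(2, ℤ)) (z : ℍ) :
    E2 (γ • z) = (((γ 1 0 : ℤ) : ℂ) * z + ((γ 1 1 : ℤ) : ℂ)) ^ 2 * E2 z -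
      6 * Complex.I * ((γ 1 0 : ℤ) : ℂ) * (((γ 1 0 : ℤ) : ℂ) * z + ((γ 1 1 : ℤ) : ℂ)) / π := by
  have h := congrFun (E2_slash_action γ) z
  rw [SL_slash_apply, Pi.sub_apply, Pi.smul_apply, smul_eq_mul, D2, riemannZeta_two, ModularGroup.denom_apply] at h
  have hden := denom_int_ne_zero γ z
  have hπ : (π : ℂ) ≠ 0 := ofReal_ne_zero.2 Real.pi_ne_zero
  have h' : E2 (γ • z) = (((γ 1 0 : ℤ) : ℂ) * z + ((γ 1 1 : ℤ) : ℂ)) ^ 2 *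
      (E2 z - 1 / (2 * (π ^ 2 / 6)) * (2 * π * Complex.I * ((γ 1 0 : ℤ) : ℂ) /
        (((γ 1 0 : ℤ) : ℂ) * z + ((γ 1 1 : ℤ) : ℂ)))) := by
    have h2 : E2 (γ • z) * (((γ 1 0 : ℤ) : ℂ) * z + ((γ 1 1 : ℤ) : ℂ)) ^ (-(2 : ℤ)) =
        E2 z - 1 / (2 * (π ^ 2 / 6)) * (2 * π * Complex.I * ((γ 1 0 : ℤ) : ℂ) /
          (((γ 1 0 : ℤ) : ℂ) * z + ((γ 1 1 : ℤ) : ℂ))) := by simpa using h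
    rw [← h2, zpow_neg, zpow_ofNat]; field_simp
  rw [h']
  field_simp

/-- Entries of `sl2zMk`. [folklore] -/
@[simp] theorem sl2zMk_entry_10 (a b c d : ℤ) (h : a * d - b * c = 1) : (sl2zMk a b c d h) 1 0 = c := rfl

/-- Entries of `sl2zMk`. [folklore] -/
@[simp] theorem sl2zMk_entry_11 (a b c d : ℤ) (h : a * d - b * c = 1) : (sl2zMk a b c d h) 1 1 = d := rfl

/-- **`𝓟(γτ) = (cτ + d)²𝓟(τ)`** for `γ ∈ Γ₀(3)`. [folklore] -/
theorem eisThree_smul (γ : SL(2, ℤ)) (hγ : γ ∈ CongruenceSubgroup.Gamma0 3) (τ : ℍ) :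
    eisThree (γ • τ) = (((γ 1 0 : ℤ) : ℂ) * τ + ((γ 1 1 : ℤ) : ℂ)) ^ 2 * eisThree τ := by
  obtain ⟨k, hk⟩ := (mem_Gamma0_three_iff γ).mp hγ
  rw [eisThree, eisThree, mulThree_smul γ ⟨k, hk⟩, E2_smul, E2_smul, sl2zMk_entry_10, sl2zMk_entry_11, coe_mulThree, hk,
    Int.mul_ediv_cancel_left _ (by norm_num : (3 : ℤ) ≠ 0)]
  have hπ : (π : ℂ) ≠ 0 := ofReal_ne_zero.2 Real.pi_ne_zero
  push_cast
  field_simp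
  ring

/-! ## The points `(τ + j)/3` and the norm `N` -/

/-- `(τ + j)/3 ∈ ℍ`. [folklore] -/
def thirdPt (j : ℤ) (τ : ℍ) : ℍ := ⟨((τ : ℂ) + j) / 3, by
  rw [Complex.div_ofNat_im]; simpa using τ.im_pos⟩

/-- Coordinate of `(τ + j)/3`. [folklore] -/
@[simp] theorem coe_thirdPt (j : ℤ) (τ : ℍ) : ((thirdPt j τ : ℍ) : ℂ) = ((τ : ℂ) + j) / 3 := rfl

/-- Coordinate of `τ/3`. [folklore] -/
theorem coe_thirdPt_zero (τ : ℍ) : ((thirdPt 0 τ : ℍ) : ℂ) = (τ : ℂ) / 3 := by simp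

/-- Height of `(τ + j)/3`. [folklore] -/
theorem thirdPt_im (j : ℤ) (τ : ℍ) : (thirdPt j τ).im = τ.im / 3 := by
  rw [← UpperHalfPlane.coe_im, coe_thirdPt, Complex.div_ofNat_im]; simp

/-- **The norm `N(τ) := 𝓟(τ)𝓟(τ/3)𝓟((τ+1)/3)𝓟((τ+2)/3)`.** [folklore] -/
def normP (τ : ℍ) : ℂ := eisThree τ * (eisThree (thirdPt 0 τ) * eisThree (thirdPt 1 τ) * eisThree (thirdPt 2 τ))

/-- `((τ+1) + j)/3 = (τ + (j+1))/3`. [folklore] -/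
theorem thirdPt_vadd_one (j : ℤ) (τ : ℍ) : thirdPt j ((1 : ℝ) +ᵥ τ) = thirdPt (j + 1) τ := by
  apply UpperHalfPlane.ext
  simp only [coe_thirdPt, UpperHalfPlane.coe_vadd]; push_cast; ring

/-- `(τ + 3)/3 = τ/3 + 1`. [folklore] -/
theorem thirdPt_three (τ : ℍ) : thirdPt 3 τ = (1 : ℝ) +ᵥ thirdPt 0 τ := by
  apply UpperHalfPlane.ext
  simp only [coe_thirdPt, UpperHalfPlane.coe_vadd]; push_cast; ring

/-- **`N(τ + 1) = N(τ)`.** [folklore] -/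
theorem normP_vadd_one (τ : ℍ) : normP ((1 : ℝ) +ᵥ τ) = normP τ := by
  rw [normP, normP, eisThree_vadd_one, thirdPt_vadd_one, thirdPt_vadd_one, thirdPt_vadd_one,
    show (0 : ℤ) + 1 = 1 by norm_num, show (1 : ℤ) + 1 = 2 by norm_num, show (2 : ℤ) + 1 = 3 by norm_num,
    thirdPt_three, eisThree_vadd_one]
  ring

/-- `3·(τ/3) = τ`, i.e. `mulThree (thirdPt 0 τ) = τ`. [folklore] -/
theorem mulThree_thirdPt_zero (τ : ℍ) : mulThree (thirdPt 0 τ) = τ := by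
  apply UpperHalfPlane.ext; rw [coe_mulThree, coe_thirdPt_zero]; ring

/-- `S•τ = W₃(τ/3)`. [folklore] -/
theorem S_smul_eq_frickeThree_thirdPt (τ : ℍ) : ModularGroup.S • τ = frickeThree (thirdPt 0 τ) := by
  apply UpperHalfPlane.ext
  rw [UpperHalfPlane.modular_S_smul, coe_frickeThree, coe_thirdPt_zero]
  show (-(τ : ℂ))⁻¹ = _
  rw [mul_div_cancel₀ _ (three_ne_zero' ℂ), inv_neg, neg_div, one_div]

/-- `(S•τ)/3 = W₃ τ`. [folklore] -/
theorem thirdPt_zero_S_smul (τ : ℍ) : thirdPt 0 (ModularGroup.S • τ) = frickeThree τ := by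
  apply UpperHalfPlane.ext
  rw [coe_thirdPt_zero, UpperHalfPlane.modular_S_smul, coe_frickeThree]
  show (-(τ : ℂ))⁻¹ / 3 = _
  have hτ : (τ : ℂ) ≠ 0 := τ.ne_zero
  rw [inv_neg, neg_div, neg_div]
  field_simp

/-- The element `(1, −1; 3, −2) ∈ Γ₀(3)`. [folklore] -/
def gOne : SL(2, ℤ) := ⟨!![1, -1; 3, -2], by norm_num [Matrix.det_fin_two_of]⟩

/-- The element `(2, −1; 3, −1) ∈ Γ₀(3)`. [folklore] -/
def gTwo : SL(2, ℤ) := ⟨!![2, -1; 3, -1], by norm_num [Matrix.det_fin_two_of]⟩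

/-- Entries and membership of `gOne`, `gTwo`. [folklore] -/
theorem gOne_gTwo_facts :
    (gOne 0 0 = 1 ∧ gOne 0 1 = -1 ∧ gOne 1 0 = 3 ∧ gOne 1 1 = -2) ∧
      (gTwo 0 0 = 2 ∧ gTwo 0 1 = -1 ∧ gTwo 1 0 = 3 ∧ gTwo 1 1 = -1) ∧
      gOne ∈ CongruenceSubgroup.Gamma0 3 ∧ gTwo ∈ CongruenceSubgroup.Gamma0 3 := by
  have h1 : gOne 0 0 = 1 ∧ gOne 0 1 = -1 ∧ gOne 1 0 = 3 ∧ gOne 1 1 = -2 := by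
    refine ⟨?_, ?_, ?_, ?_⟩ <;> rfl
  have h2 : gTwo 0 0 = 2 ∧ gTwo 0 1 = -1 ∧ gTwo 1 0 = 3 ∧ gTwo 1 1 = -1 := by
    refine ⟨?_, ?_, ?_, ?_⟩ <;> rfl
  refine ⟨h1, h2, ?_, ?_⟩
  · rw [mem_Gamma0_three_iff, h1.2.2.1]
  · rw [mem_Gamma0_three_iff, h2.2.2.1]

/-- `((S•τ) + 1)/3 = gOne • ((τ + 2)/3)`. [folklore] -/
theorem thirdPt_one_S_smul (τ : ℍ) : thirdPt 1 (ModularGroup.S • τ) = gOne • thirdPt 2 τ := by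
  obtain ⟨⟨e00, e01, e10, e11⟩, -, -, -⟩ := gOne_gTwo_facts
  apply UpperHalfPlane.ext
  rw [coe_thirdPt, UpperHalfPlane.modular_S_smul, coe_smul_eq, e00, e01, e10, e11, coe_thirdPt]
  show ((-(τ : ℂ))⁻¹ + ((1 : ℤ) : ℂ)) / 3 = _
  have hτ : (τ : ℂ) ≠ 0 := τ.ne_zero
  have h3 : ((3 : ℤ) : ℂ) * (((τ : ℂ) + ((2 : ℤ) : ℂ)) / 3) + ((-2 : ℤ) : ℂ) = τ := by push_cast; ring
  rw [h3, div_eq_div_iff (three_ne_zero' ℂ) hτ, inv_neg]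
  push_cast
  field_simp
  ring

/-- `((S•τ) + 2)/3 = gTwo • ((τ + 1)/3)`. [folklore] -/
theorem thirdPt_two_S_smul (τ : ℍ) : thirdPt 2 (ModularGroup.S • τ) = gTwo • thirdPt 1 τ := by
  obtain ⟨-, ⟨e00, e01, e10, e11⟩, -, -⟩ := gOne_gTwo_facts
  apply UpperHalfPlane.ext
  rw [coe_thirdPt, UpperHalfPlane.modular_S_smul, coe_smul_eq, e00, e01, e10, e11, coe_thirdPt]
  show ((-(τ : ℂ))⁻¹ + ((2 : ℤ) : ℂ)) / 3 = _
  have hτ : (τ : ℂ) ≠ 0 := τ.ne_zero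
  have h3 : ((3 : ℤ) : ℂ) * (((τ : ℂ) + ((1 : ℤ) : ℂ)) / 3) + ((-1 : ℤ) : ℂ) = τ := by push_cast; ring
  rw [h3, div_eq_div_iff (three_ne_zero' ℂ) hτ, inv_neg]
  push_cast
  field_simp
  ring

/-- **`N(−1/τ) = τ⁸N(τ)`.** [folklore] -/
theorem normP_S_smul (τ : ℍ) : normP (ModularGroup.S • τ) = (τ : ℂ) ^ 8 * normP τ := by
  obtain ⟨⟨-, -, e10, e11⟩, ⟨-, -, f10, f11⟩, h1, h2⟩ := gOne_gTwo_facts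
  rw [normP, normP, thirdPt_zero_S_smul, thirdPt_one_S_smul, thirdPt_two_S_smul, S_smul_eq_frickeThree_thirdPt,
    eisThree_fricke, eisThree_fricke, eisThree_smul gOne h1, eisThree_smul gTwo h2, e10, e11, f10, f11,
    coe_thirdPt, coe_thirdPt, coe_thirdPt]
  push_cast
  ring

/-! ## `N` is a level-one modular form of weight `8` -/

/-- `thirdPt` through `ofComplex`. [folklore] -/
theorem thirdPt_ofComplex (j : ℤ) {w : ℂ} (hw : 0 < w.im) : thirdPt j (ofComplex w) = ofComplex ((w + j) / 3) := by
  have hw' : 0 < ((w + j) / 3).im := by rw [Complex.div_ofNat_im]; simpa using hw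
  apply UpperHalfPlane.ext
  rw [coe_thirdPt, ofComplex_apply_of_im_pos hw, ofComplex_apply_of_im_pos hw']

/-- `𝓟 ∘ thirdPt j ∘ ofComplex` is differentiable. [folklore] -/
theorem differentiableAt_eisThree_thirdPt (j : ℤ) {w : ℂ} (hw : 0 < w.im) :
    DifferentiableAt ℂ (fun u : ℂ => eisThree (thirdPt j (ofComplex u))) w := by
  have hw' : 0 < ((w + j) / 3).im := by rw [Complex.div_ofNat_im]; simpa using hw
  have h : DifferentiableAt ℂ ((eisThree ∘ ofComplex) ∘ fun u : ℂ => (u + j) / 3) w :=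
    (differentiableAt_eisThree hw').comp w (by fun_prop)
  refine h.congr_of_eventuallyEq ?_
  filter_upwards [isOpen_upperHalfPlaneSet.mem_nhds hw] with u hu
  simp only [Function.comp_apply, thirdPt_ofComplex j hu]

/-- **`N` is holomorphic.** [folklore] -/
theorem mdifferentiable_normP : MDiff normP := by
  rw [UpperHalfPlane.mdifferentiable_iff]
  intro w hw
  have h0 := differentiableAt_eisThree hw
  have h := h0.mul (((differentiableAt_eisThree_thirdPt 0 hw).mul (differentiableAt_eisThree_thirdPt 1 hw)).mul
    (differentiableAt_eisThree_thirdPt 2 hw))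
  refine (h.congr_of_eventuallyEq ?_).differentiableWithinAt
  filter_upwards [isOpen_upperHalfPlaneSet.mem_nhds hw] with u hu
  simp only [Function.comp_apply, normP, Pi.mul_apply]

/-- `thirdPt j → i∞`. [folklore] -/
theorem tendsto_thirdPt_atImInfty (j : ℤ) : Tendsto (thirdPt j) atImInfty atImInfty := by
  rw [atImInfty, tendsto_comap_iff]
  have : (UpperHalfPlane.im ∘ thirdPt j) = fun τ => τ.im / 3 := funext fun τ => thirdPt_im j τ
  rw [this]
  exact Filter.Tendsto.atTop_div_const (by norm_num) tendsto_comap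

/-- **`N → 1` at `i∞`.** [folklore] -/
theorem tendsto_normP : Tendsto normP atImInfty (𝓝 1) := by
  have h := tendsto_eisThree.mul (((tendsto_eisThree.comp (tendsto_thirdPt_atImInfty 0)).mul
    (tendsto_eisThree.comp (tendsto_thirdPt_atImInfty 1))).mul (tendsto_eisThree.comp (tendsto_thirdPt_atImInfty 2)))
  simp only [mul_one] at h
  exact h.congr fun τ => rfl

/-- `N |₈ S = N` and `N |₈ T = N`. [folklore] -/
theorem normP_slash_S_T : normP ∣[(8 : ℤ)] ModularGroup.S = normP ∧ normP ∣[(8 : ℤ)] ModularGroup.T = normP := by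
  constructor
  · funext τ
    rw [SL_slash_apply, ModularGroup.denom_S, normP_S_smul, zpow_neg, zpow_ofNat]
    have hτ : (τ : ℂ) ≠ 0 := τ.ne_zero
    field_simp
  · funext τ
    rw [SL_slash_apply, UpperHalfPlane.modular_T_smul, normP_vadd_one, ModularGroup.denom_apply]
    simp [ModularGroup.T]

/-- `N` is invariant under every `γ ∈ SL₂(ℤ)` in weight `8`. [folklore] -/
theorem normP_slash (γ : SL(2, ℤ)) : normP ∣[(8 : ℤ)] (γ : GL (Fin 2) ℝ) = normP := by
  have := SlashInvariantForm.slash_action_generators_SL2Z normP_slash_S_T.1 normP_slash_S_T.2 γ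
  simpa [SL_slash] using this

/-- `N` is bounded at `i∞`. [folklore] -/
theorem isBoundedAtImInfty_normP : IsBoundedAtImInfty normP :=
  tendsto_normP.isBigO_one ℝ

/-- **`N` as a modular form of weight `8` and level one.** [folklore] -/
def normPForm : ModularForm 𝒮ℒ 8 where
  toFun := normP
  slash_action_eq' := by
    intro A hA
    obtain ⟨γ, rfl⟩ := hA
    exact normP_slash γ
  holo' := mdifferentiable_normP
  bdd_at_cusps' hc := by
    rw [OnePoint.isBoundedAt_iff_forall_SL2Z hc]
    intro γ _
    show IsBoundedAtImInfty (normP ∣[(8 : ℤ)] (γ : GL (Fin 2) ℝ))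
    rw [normP_slash γ]
    exact isBoundedAtImInfty_normP

/-- Coercion of `normPForm`. [folklore] -/
theorem coe_normPForm : (normPForm : ℍ → ℂ) = normP := rfl

/-- **`N = c·E₄²`** for some constant (`dim M₈(SL₂(ℤ)) = 1`). [folklore] -/
theorem exists_normP_eq_smul_E₄_sq : ∃ c : ℂ, ∀ τ : ℍ, normP τ = c * (E₄ τ) ^ 2 := by
  have hr : Module.finrank ℂ (ModularForm 𝒮ℒ 8) = 1 :=
    Module.finrank_eq_of_rank_eq (by simpa using Literature.Barriers.Schanuel.levelOne_weight_eight_rank_one)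
  set E8 : ModularForm 𝒮ℒ 8 := (E₄.mul E₄ : ModularForm 𝒮ℒ (4 + 4)) with hE8
  have hE8ne : E8 ≠ 0 := by
    intro h0
    have h1 : (E8 : ℍ → ℂ) UpperHalfPlane.I = 0 := by rw [h0]; rfl
    have h2 : (E8 : ℍ → ℂ) UpperHalfPlane.I = E₄ UpperHalfPlane.I * E₄ UpperHalfPlane.I := rfl
    rw [h2] at h1
    have hE4 : E₄ UpperHalfPlane.I ≠ 0 := by
      intro h
      obtain ⟨γ, hγ⟩ := E₄_eq_zero_iff.mp h
      -- `γ•ρ = i` is impossible: heights `Im(γρ) = (√3/2)/(c² − cd + d²) ≠ 1`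
      have him : (γ • UpperHalfPlane.ρ).im = 1 := by rw [hγ]; rfl
      rw [im_smul_eq] at him
      simp only [Complex.normSq_apply, Complex.add_re, Complex.mul_re, Complex.intCast_re, UpperHalfPlane.coe_re,
        Complex.intCast_im, UpperHalfPlane.coe_im, Complex.add_im, Complex.mul_im, add_zero, zero_mul, sub_zero] at him
      rw [show UpperHalfPlane.ρ.re = -1 / 2 from rfl, show UpperHalfPlane.ρ.im = Real.sqrt 3 / 2 from rfl] at him
      have hs : Real.sqrt 3 * Real.sqrt 3 = 3 := Real.mul_self_sqrt (by norm_num)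
      have hirr : Irrational (Real.sqrt 3) := by
        simpa using Nat.Prime.irrational_sqrt (p := 3) (by norm_num)
      -- `√3/2 = Q` with `Q = c² − cd + d² ∈ ℤ`
      set c : ℝ := ((γ 1 0 : ℤ) : ℝ)
      set d : ℝ := ((γ 1 1 : ℤ) : ℝ)
      have hQ : Real.sqrt 3 / 2 = (c * (-1 / 2) + d) * (c * (-1 / 2) + d) + c * (Real.sqrt 3 / 2) * (c * (Real.sqrt 3 / 2)) := by
        have hpos : 0 < (c * (-1 / 2) + d) * (c * (-1 / 2) + d) + c * (Real.sqrt 3 / 2) * (c * (Real.sqrt 3 / 2)) := by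
          by_contra hle; push Not at hle
          have : Real.sqrt 3 / 2 / _ ≤ 0 := div_nonpos_of_nonneg_of_nonpos (by positivity) hle
          linarith
        rw [div_eq_iff hpos.ne'] at him; linarith
      have hQ' : Real.sqrt 3 / 2 = c * c - c * d + d * d := by nlinarith [hQ, hs]
      apply hirr.ne_rat (2 * ((γ 1 0) * (γ 1 0) - (γ 1 0) * (γ 1 1) + (γ 1 1) * (γ 1 1)) : ℚ)
      push_cast
      simp only [c, d] at hQ'
      linarith
    exact hE4 (mul_self_eq_zero.mp h1)
  obtain ⟨c, hc⟩ := (finrank_eq_one_iff_of_nonzero' E8 hE8ne).mp hr normPForm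
  refine ⟨c, fun τ => ?_⟩
  have := congrArg (fun F : ModularForm 𝒮ℒ 8 => (F : ℍ → ℂ) τ) hc
  have h1 : ((c • E8 : ModularForm 𝒮ℒ 8) : ℍ → ℂ) τ = c * (E₄ τ * E₄ τ) := rfl
  have h2 : ((normPForm : ModularForm 𝒮ℒ 8) : ℍ → ℂ) τ = normP τ := rfl
  simp only [h1, h2] at this
  rw [← this]
  ring

/-! ## The zero locus -/

/-- **A zero `τ₀` of `𝓟` forces `E₄(3τ₀) = 0`** (`N(3τ₀)` contains the factor `𝓟(τ₀)`, and
`N = cE₄²` with `c ≠ 0` since `N → 1`). [folklore] -/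
theorem E₄_mulThree_eq_zero_of_eisThree_eq_zero {τ₀ : ℍ} (h : eisThree τ₀ = 0) : E₄ (mulThree τ₀) = 0 := by
  obtain ⟨c, hc⟩ := exists_normP_eq_smul_E₄_sq
  have hc0 : c ≠ 0 := by
    rintro rfl
    have h0 : normP = fun _ => 0 := funext fun τ => by rw [hc]; ring
    have := tendsto_normP
    rw [h0] at this
    exact one_ne_zero (tendsto_nhds_unique tendsto_const_nhds this).symm
  have hN : normP (mulThree τ₀) = 0 := by
    rw [normP, mulThree_thirdPt_zero', h]; ring
  rw [hc] at hN
  exact pow_eq_zero_iff two_ne_zero |>.mp ((mul_eq_zero.mp hN).resolve_left hc0)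
where
  /-- `(3τ)/3 = τ`. [folklore] -/
  mulThree_thirdPt_zero' : thirdPt 0 (mulThree τ₀) = τ₀ := by
    apply UpperHalfPlane.ext; simp [coe_mulThree]

/-- **Zeros of `𝓟` have height `≤ √3/6`.** [cite: Zhou2015, Remark 9] -/
theorem im_le_of_eisThree_eq_zero {τ₀ : ℍ} (h : eisThree τ₀ = 0) : τ₀.im ≤ Real.sqrt 3 / 6 := by
  obtain ⟨γ, hγ⟩ := E₄_eq_zero_iff.mp (E₄_mulThree_eq_zero_of_eisThree_eq_zero h)
  have him : (γ • UpperHalfPlane.ρ).im = 3 * τ₀.im := by rw [hγ, mulThree_im]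
  rw [im_smul_eq] at him
  -- `|cρ + d|² = c² − cd + d² ≥ 1`
  have hn : 1 ≤ Complex.normSq (((γ 1 0 : ℤ) : ℂ) * UpperHalfPlane.ρ + ((γ 1 1 : ℤ) : ℂ)) := by
    rw [Complex.normSq_apply]
    simp only [Complex.add_re, Complex.mul_re, Complex.intCast_re, UpperHalfPlane.coe_re, Complex.intCast_im,
      UpperHalfPlane.coe_im, Complex.add_im, Complex.mul_im, add_zero, zero_mul, sub_zero]
    rw [show UpperHalfPlane.ρ.re = -1 / 2 from rfl, show UpperHalfPlane.ρ.im = Real.sqrt 3 / 2 from rfl]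
    have hs : Real.sqrt 3 * Real.sqrt 3 = 3 := Real.mul_self_sqrt (by norm_num)
    have hcd : (γ 1 0) ≠ 0 ∨ (γ 1 1) ≠ 0 := by
      by_contra h0; push Not at h0
      have hdet := det_two_entries γ
      rw [h0.1, h0.2] at hdet; simp at hdet
    have hint : (1 : ℤ) ≤ (γ 1 0) ^ 2 - (γ 1 0) * (γ 1 1) + (γ 1 1) ^ 2 := by
      rcases hcd with hc | hd
      · nlinarith [Int.one_le_abs hc, sq_abs (γ 1 0), sq_nonneg (2 * γ 1 1 - γ 1 0), sq_nonneg (γ 1 1)]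
      · nlinarith [Int.one_le_abs hd, sq_abs (γ 1 1), sq_nonneg (2 * γ 1 0 - γ 1 1), sq_nonneg (γ 1 0)]
    have hreal : (1 : ℝ) ≤ ((γ 1 0 : ℤ) : ℝ) ^ 2 - ((γ 1 0 : ℤ) : ℝ) * ((γ 1 1 : ℤ) : ℝ) + ((γ 1 1 : ℤ) : ℝ) ^ 2 := by
      exact_mod_cast hint
    nlinarith [hreal, hs]
  have hρ : UpperHalfPlane.ρ.im = Real.sqrt 3 / 2 := rfl
  rw [hρ] at him
  have h3 : 3 * τ₀.im ≤ Real.sqrt 3 / 2 := by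
    rw [← him]
    exact div_le_self (by positivity) hn
  linarith

/-- **`𝓟(τ) ≠ 0` for `Im τ > √3/6`.** [cite: Zhou2015, Remark 9] -/
theorem eisThree_ne_zero_of_im_gt {τ : ℍ} (hτ : Real.sqrt 3 / 6 < τ.im) : eisThree τ ≠ 0 :=
  fun h => not_le.mpr hτ (im_le_of_eisThree_eq_zero h)

end Literature.NumberTheory.ModularForms

end
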